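import Mathlib
import Summits.Ventures.LatticeQCDFlow.Scaling.U1ConnectedSums

/-!
# LatticeQCDFlow / Scaling — `U(1)` on the torus: `E[X Y C'⁴] = 3/4`
# (only the `4!` orderings of the lateral faces survive, each worth the cube moment `1/32`)

HONEST FRAMING: exact (Metropolis-corrected) sampling algorithms for lattice gauge theory;
figures of merit are autocorrelation/cost numbers at stated couplings and volumes; no
continuum-physics claim.

Venture `LatticeQCDFlow` (cell pub-lqcd), topic `Scaling`, FANOUT row 30 (lean-1) — OUR WORK, the
lattice half of the leading-coefficient identity (LC) of theory2 item 120
(HOME/lean/theory2/LANDING.md §32), part 4, the connected fourth moment.  With `X = c_top`,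
`Y = c_bot`, `C' = ∑_{q ∈ rest} c_q` (`Scaling/U1ConnectedSums.lean`): expanding `C'⁴` over
quadruples `p : Fin 4 → rest`, a quadruple contributes `0` unless its bonds cover every bond of
`top` and of `bot` (an uncovered bond is peeled, `U1AtomicMoments.integral_mul_X_eq_zero`), in
which case it is an ordering of the four lateral faces (`exists_perm_latVec_of_covers`, from
`TorusPlaquetteGeometry.eq_of_two_mem_tbonds` and `TorusCubeGeometry.mem_lat_of_touches`) and
contributes the cube moment `1/32` (`U1CubeMoment.integral_cube_eq`); the `4! = 24` orderings give
**`integral_XY_Crest_four`: `E[X Y C'⁴] = 24/32 = 3/4`** — the `t = 1` instance of the printed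
leading tube of the plaquette–plaquette correlation [cite: MontvayMunster1994, §3.6.2 (3.437)].
Elementary; nothing is cited as a fact; no `def`, no `sorry`.
-/

noncomputable section

open MeasureTheory Filter Topology Finset
open Literature.MathematicalPhysics.QuantumFieldTheory
open Summit.Ventures.LatticeQCDFlow.Theory2.Lattice.TorusGeom

namespace Summit.Ventures.LatticeQCDFlow.Theory2.Lattice.U1Torus

variable {d L : ℕ} [NeZero L] {i j a : Fin d}

/-! ## Four other plaquettes: only the orderings of the lateral faces survive -/

omit [NeZero L] in
/-- **Four genuine plaquettes, none of them `top` or `bot`, whose bonds cover all bonds of `top`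
and all bonds of `bot`, are the four lateral faces in some order.** [folklore] -/
theorem exists_perm_latVec_of_covers (hL : 3 ≤ L) (hij : i < j) (hai : a ≠ i) (haj : a ≠ j)
    (p : Fin 4 → TPlaq d L) (hgen : ∀ m, (p m).2.1 < (p m).2.2) (hT : ∀ m, p m ≠ top i j)
    (hB : ∀ m, p m ≠ bot i j a)
    (hcovT : ∀ b ∈ (top i j : TPlaq d L).tbonds, ∃ m, b ∈ (p m).tbonds)
    (hcovB : ∀ b ∈ (bot i j a : TPlaq d L).tbonds, ∃ m, b ∈ (p m).tbonds) :
    ∃ σ : Equiv.Perm (Fin 4), ∀ m, p m = latVec i j a (σ m) := by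
  classical
  have hL2 : 2 ≤ L := by omega
  have htopg : (top (L := L) i j).2.1 < (top (L := L) i j).2.2 := hij
  have hbotg : (bot (L := L) i j a).2.1 < (bot (L := L) i j a).2.2 := hij
  -- every `p m` touches `top` and `bot`: the covering map from the four bonds is injective
  have touch : ∀ (r : TPlaq d L), r.2.1 < r.2.2 → (∀ m, p m ≠ r) →
      (∀ b ∈ r.tbonds, ∃ m, b ∈ (p m).tbonds) → ∀ m, ∃ b ∈ r.tbonds, b ∈ (p m).tbonds := by
    intro r hr hne hcov
    choose! g hg using hcov
    -- `g` restricted to `r.tbonds` is injective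
    have hinj : Set.InjOn g r.tbonds := by
      intro b hb b' hb' hgg
      by_contra hbb
      have h1 := hg b hb
      have h2 := hg b' hb'
      rw [hgg] at h1
      exact hne (g b') (eq_of_two_mem_tbonds hL (hgen _) hr hbb h1 hb h2 hb')
    have hcard : (r.tbonds.image g).card = 4 := by
      rw [Finset.card_image_of_injOn hinj, card_tbonds hL2 hr]
    have huniv : r.tbonds.image g = Finset.univ := by
      apply Finset.eq_univ_of_card
      rw [hcard, Fintype.card_fin]
    intro m
    have hm : m ∈ r.tbonds.image g := by rw [huniv]; exact Finset.mem_univ _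
    obtain ⟨b, hb, rfl⟩ := Finset.mem_image.1 hm
    exact ⟨b, hb, hg b hb⟩
  have hlat : ∀ m, ∃ n : Fin 4, p m = latVec i j a n := by
    intro m
    obtain ⟨b, hbT, hbq⟩ := touch _ htopg hT hcovT m
    obtain ⟨b', hb'B, hb'q⟩ := touch _ hbotg hB hcovB m
    exact exists_latVec_eq_of_or (mem_lat_of_touches hL hai haj (hgen m) hbq hbT hb'q hb'B)
  choose σ hσ using hlat
  -- `σ` is injective: equal lateral faces would contain two distinct bonds of `top`
  have hσ_inj : Function.Injective σ := by
    intro m m' hmm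
    by_contra hne
    have hpp : p m = p m' := by rw [hσ m, hσ m', hmm]
    -- the covering map of `top` is injective, so `m ≠ m'` receive distinct bonds
    choose! g hg using hcovT
    have hinj : Set.InjOn g (top i j : TPlaq d L).tbonds := by
      intro b hb b' hb' hgg
      by_contra hbb
      have h1 := hg b hb
      have h2 := hg b' hb'
      rw [hgg] at h1
      exact hT (g b') (eq_of_two_mem_tbonds hL (hgen _) htopg hbb h1 hb h2 hb')
    have huniv : (top i j : TPlaq d L).tbonds.image g = Finset.univ := by
      apply Finset.eq_univ_of_card
      rw [Finset.card_image_of_injOn hinj, card_tbonds hL2 htopg, Fintype.card_fin]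
    obtain ⟨b, hb, hgb⟩ := Finset.mem_image.1 (huniv ▸ Finset.mem_univ m)
    obtain ⟨b', hb', hgb'⟩ := Finset.mem_image.1 (huniv ▸ Finset.mem_univ m')
    have hbb : b ≠ b' := fun h => hne (by rw [← hgb, ← hgb', h])
    have h1 : b ∈ (p m).tbonds := hgb ▸ hg b hb
    have h2 : b' ∈ (p m).tbonds := by rw [hpp]; exact hgb' ▸ hg b' hb'
    exact hT m (eq_of_two_mem_tbonds hL (hgen m) htopg hbb h1 hb h2 hb')
  exact ⟨Equiv.ofBijective σ hσ_inj.bijective_of_finite, fun m => hσ m⟩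

omit [NeZero L] in
/-- Reversing the orientation of a label does not change its cosine. [folklore] -/
theorem cosT_swap (y : Site d L) (m n : Fin d) (U : ZdGaugeConfig d Circle) :
    cosT L (y, n, m) U = cosT L (y, m, n) U := by
  have h : (holT L (y, n, m) U : ℂ) = ((holT L (y, m, n) U : ℂ))⁻¹ := by
    simp only [holT, plaquetteHolonomy, torusSigma_apply, Circle.coe_mul, Circle.coe_inv]
    field_simp
  unfold cosT
  rw [h, Complex.inv_re, Complex.normSq_eq_norm_sq, Circle.norm_coe]
  simp

omit [NeZero L] in
/-- The cosine of a sorted label is that of the unsorted one. [folklore] -/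
theorem cosT_srt (y : Site d L) (m n : Fin d) (U : ZdGaugeConfig d Circle) :
    cosT L (srt y m n) U = cosT L (y, m, n) U := by
  unfold srt
  split_ifs
  · rfl
  · exact cosT_swap y m n U

omit [NeZero L] in
/-- `|∏ c_{p m}| ≤ 1`. [folklore] -/
theorem norm_prod_cosT_le (p : Fin 4 → TPlaq d L) (U : ZdGaugeConfig d Circle) :
    ‖∏ m, cosT L (p m) U‖ ≤ 1 := by
  rw [norm_prod]
  exact Finset.prod_le_one (fun _ _ => norm_nonneg _)
    fun m _ => by rw [Real.norm_eq_abs]; exact abs_cosT_le_one L _ U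

/-- **An ordering of the lateral faces contributes the cube moment `1/32`.** [folklore] -/
theorem integral_XY_prod_latVec (hL : 3 ≤ L) (hij : i < j) (hai : a ≠ i) (haj : a ≠ j)
    (σ : Equiv.Perm (Fin 4)) :
    ∫ U, cosT L (top i j) U ^ 1 * cosT L (bot i j a) U ^ 1 *
        ∏ m, cosT L (latVec i j a (σ m)) U ∂(zdHaar d Circle) = 1 / 32 := by
  have hprod : ∀ U : ZdGaugeConfig d Circle, ∏ m, cosT L (latVec i j a (σ m)) U =
      cosT L (-Pi.single a 1, i, a) U * cosT L (-Pi.single a 1 + Pi.single j 1, i, a) U *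
        (cosT L (-Pi.single a 1, j, a) U * cosT L (-Pi.single a 1 + Pi.single i 1, j, a) U) := by
    intro U
    rw [Equiv.prod_comp σ (fun n => cosT L (latVec i j a n) U), Fin.prod_univ_four]
    have e0 : latVec (L := L) i j a 0 = latI i a := rfl
    have e1 : latVec (L := L) i j a 1 = latI' i j a := rfl
    have e2 : latVec (L := L) i j a 2 = latJ j a := rfl
    have e3 : latVec (L := L) i j a 3 = latJ' i j a := rfl
    simp only [e0, e1, e2, e3, latI, latI', latJ, latJ', cosT_srt]
    ring
  simp_rw [hprod, pow_one]
  rw [← integral_cube_eq hL hij hai haj]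
  refine integral_congr_ae (Eventually.of_forall fun U => ?_)
  simp only
  ring

/-- **Any other quadruple of genuine plaquettes leaves a bond of `top` or of `bot` uncovered and
contributes `0`.** [folklore] -/
theorem integral_XY_prod_eq_zero (hL : 3 ≤ L) (hij : i < j) (hai : a ≠ i) (haj : a ≠ j)
    (p : Fin 4 → TPlaq d L) (hp : ∀ m, p m ∈ rest L i j a)
    (hno : ¬ ∃ σ : Equiv.Perm (Fin 4), ∀ m, p m = latVec i j a (σ m)) :
    ∫ U, cosT L (top i j) U ^ 1 * cosT L (bot i j a) U ^ 1 * ∏ m, cosT L (p m) U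
      ∂(zdHaar d Circle) = 0 := by
  have hL2 : 2 ≤ L := by omega
  have hgen : ∀ m, (p m).2.1 < (p m).2.2 := fun m => (mem_rest.1 (hp m)).1
  have hT : ∀ m, p m ≠ top i j := fun m => (mem_rest.1 (hp m)).2.1
  have hB : ∀ m, p m ≠ bot i j a := fun m => (mem_rest.1 (hp m)).2.2
  have hnc : ¬ ((∀ b ∈ (top (L := L) i j).tbonds, ∃ m, b ∈ (p m).tbonds) ∧
      (∀ b ∈ (bot (L := L) i j a).tbonds, ∃ m, b ∈ (p m).tbonds)) := fun h =>
    hno (exists_perm_latVec_of_covers hL hij hai haj p hgen hT hB h.1 h.2)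
  have hPc : Continuous fun U : ZdGaugeConfig d Circle => ∏ m, cosT L (p m) U :=
    continuous_finsetProd _ fun m _ => continuous_cosT L (p m)
  rw [not_and_or] at hnc
  rcases hnc with h | h
  · -- a bond of `top` is uncovered
    push Not at h
    obtain ⟨b, hb, hbp⟩ := h
    have hbB : b ∉ (bot (L := L) i j a).tbonds := fun h' =>
      Finset.disjoint_left.1 (disjoint_tbonds_top_bot hL2 hai haj) hb h'
    have e : (fun U => cosT L (top i j) U ^ 1 * cosT L (bot i j a) U ^ 1 * ∏ m, cosT L (p m) U) =
        fun U => (cosT L (bot i j a) U * ∏ m, cosT L (p m) U) * cosT L (top i j) U := by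
      funext U; ring
    rw [e]
    refine integral_mul_X_eq_zero hL2 hij ((continuous_cosT L _).mul hPc).measurable (K := 1)
      (fun U => ?_) hb (fun z U => ?_)
    · rw [norm_mul]
      exact mul_le_one₀ (by rw [Real.norm_eq_abs]; exact abs_cosT_le_one L _ U) (norm_nonneg _)
        (norm_prod_cosT_le p U)
    · rw [cosT_mulSingle_of_not_mem hbB]
      congr 1
      exact Finset.prod_congr rfl fun m _ => cosT_mulSingle_of_not_mem (hbp m) z U
  · -- a bond of `bot` is uncovered
    push Not at h
    obtain ⟨b, hb, hbp⟩ := h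
    have hbT : b ∉ (top (L := L) i j).tbonds := fun h' =>
      Finset.disjoint_left.1 (disjoint_tbonds_top_bot hL2 hai haj) h' hb
    have e : (fun U => cosT L (top i j) U ^ 1 * cosT L (bot i j a) U ^ 1 * ∏ m, cosT L (p m) U) =
        fun U => (cosT L (top i j) U * ∏ m, cosT L (p m) U) * cosT L (bot i j a) U := by
      funext U; ring
    rw [e]
    refine integral_mul_Y_eq_zero hL2 hij ((continuous_cosT L _).mul hPc).measurable (K := 1)
      (fun U => ?_) hb (fun z U => ?_)
    · rw [norm_mul]
      exact mul_le_one₀ (by rw [Real.norm_eq_abs]; exact abs_cosT_le_one L _ U) (norm_nonneg _)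
        (norm_prod_cosT_le p U)
    · rw [cosT_mulSingle_of_not_mem hbT]
      congr 1
      exact Finset.prod_congr rfl fun m _ => cosT_mulSingle_of_not_mem (hbp m) z U

/-- **`E[X Y C'⁴] = 3/4`**: `C'⁴` expands over quadruples of other plaquettes; only the `4!`
orderings of the four lateral faces contribute, each the cube moment `1/32`. [folklore] -/
theorem integral_XY_Crest_four (hL : 3 ≤ L) (hij : i < j) (hai : a ≠ i) (haj : a ≠ j) :
    ∫ U, cosT L (top i j) U ^ 1 * cosT L (bot i j a) U ^ 1 * Crest L i j a U ^ 4
      ∂(zdHaar d Circle) = 3 / 4 := by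
  classical
  have hL2 : 2 ≤ L := by omega
  set S := Fintype.piFinset fun _ : Fin 4 => rest L i j a with hS
  have hexp : ∀ U, cosT L (top i j) U ^ 1 * cosT L (bot i j a) U ^ 1 * Crest L i j a U ^ 4 =
      ∑ p ∈ S, cosT L (top i j) U ^ 1 * cosT L (bot i j a) U ^ 1 * ∏ m, cosT L (p m) U := by
    intro U
    rw [Crest, Finset.sum_pow', Finset.mul_sum]
  have hint : ∀ p : Fin 4 → TPlaq d L, Integrable (fun U => cosT L (top i j) U ^ 1 *
      cosT L (bot i j a) U ^ 1 * ∏ m, cosT L (p m) U) (zdHaar d Circle) := fun p =>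
    integrable_of_continuous' ((continuous_XYpow 1 1).mul
      (continuous_finsetProd _ fun m _ => continuous_cosT L (p m))) (K := 1) fun U => by
        rw [norm_mul]
        exact mul_le_one₀ (norm_XYpow_le 1 1 U) (norm_nonneg _) (norm_prod_cosT_le p U)
  simp_rw [hexp]
  rw [integral_finsetSum _ fun p _ => hint p]
  -- the surviving index set: orderings of the lateral faces
  set Good : Finset (Fin 4 → TPlaq d L) :=
    Finset.univ.image fun σ : Equiv.Perm (Fin 4) => fun m => latVec i j a (σ m) with hGood
  have hsub : Good ⊆ S := by
    intro p hp
    obtain ⟨σ, -, rfl⟩ := Finset.mem_image.1 hp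
    rw [hS, Fintype.mem_piFinset]
    intro m
    exact mem_rest.2 ⟨latVec_genuine hai haj _, latVec_ne_top hai haj _, latVec_ne_bot hai haj _⟩
  rw [← Finset.sum_subset hsub]
  · rw [hGood, Finset.sum_image]
    · simp_rw [integral_XY_prod_latVec hL hij hai haj]
      rw [Finset.sum_const, Finset.card_univ, Fintype.card_perm, Fintype.card_fin]
      norm_num [Nat.factorial]
    · intro σ _ σ' _ h
      ext m
      have := congr_fun h m
      exact congr_arg Fin.val (latVec_injective hL2 (Fin.ne_of_lt hij) hai this)
  · intro p hpS hpG
    refine integral_XY_prod_eq_zero hL hij hai haj p (fun m => ?_) (fun ⟨σ, hσ⟩ => hpG ?_)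
    · rw [hS, Fintype.mem_piFinset] at hpS
      exact hpS m
    · rw [hGood, Finset.mem_image]
      exact ⟨σ, Finset.mem_univ _, (funext hσ).symm⟩

end Summit.Ventures.LatticeQCDFlow.Theory2.Lattice.U1Torus

end
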